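/-
Copyright (c) 2026 the pub-hodgecm-mathlib formalisation cell (harness21).  Prover seat hodgecm-mathlib-LA2-p02 (g7), organ payer of half-A line L2
(«M-152» SEQUEL ★ chain, part F2; map LA2-p03 (g9) 2026-09-03T05:57Z), 2026-09-03.  THEOREMS ONLY (no definition, no named fact, no `sorry`, no instance,
no notation).  `--supports stmt-HodgeConjecture-24832 --as helper`.
-/
import Summits.HodgeConjecture.HodgeConjecture.Theorems.F0LD2PinToAdmissible
import Summits.HodgeConjecture.HodgeConjecture.Theorems.F0LD1ThetaRealisationOfOrthogonalCopy
import Summits.HodgeConjecture.HodgeConjecture.Theorems.F0LD1ThetaSpanPinOfBricks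
import Summits.HodgeConjecture.HodgeConjecture.Theorems.F0LD2ThetaFinComponent
import Summits.HodgeConjecture.HodgeConjecture.Theorems.F0LD2ArchTypeAway
import Summits.HodgeConjecture.HodgeConjecture.Theorems.F0LD2ArchSignAt
import Summits.HodgeConjecture.HodgeConjecture.Theorems.F0LD2SameLabelClassesOfAFUCompact
import Summits.HodgeConjecture.HodgeConjecture.Theorems.F0LD2LetterR2OfLineComplementary
import Summits.HodgeConjecture.HodgeConjecture.Theorems.F0LD2LineThetaTypesComplementary1
import Summits.HodgeConjecture.HodgeConjecture.Theorems.F0LD2OperatorWords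
import Summits.HodgeConjecture.HodgeConjecture.Theorems.F0LD1ThetaIrrOfGerm
import Summits.HodgeConjecture.HodgeConjecture.Theorems.F0LD1ThetaGermDefs
import Summits.HodgeConjecture.HodgeConjecture.Theorems.F0LD1ThetaSliceOfBricks
import Summits.HodgeConjecture.HodgeConjecture.Theorems.F0LD1ThetaSliceTorusProjectorOrgan
import Summits.HodgeConjecture.HodgeConjecture.Theorems.F0LD1ThetaSliceMeasureScaling
import Summits.HodgeConjecture.HodgeConjecture.Theorems.F0LD1ThetaSliceHermiteSum
import Summits.HodgeConjecture.HodgeConjecture.Theorems.F0LD1ThetaSliceFiniteLevel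
import Summits.HodgeConjecture.HodgeConjecture.Theorems.F0LD1ThetaDichotomyBricks
import Summits.HodgeConjecture.HodgeConjecture.Theorems.F0LD1ThetaDichotomyOfBricks
import Summits.HodgeConjecture.HodgeConjecture.Theorems.F0LD1ThetaFinGeneration
import Summits.HodgeConjecture.HodgeConjecture.Theorems.F0LD1ThetaArchLadderHolds
import Summits.HodgeConjecture.HodgeConjecture.Theorems.F0P5CurveThetaCompanionRelabelOfNonsplitIfLetter
import Summits.HodgeConjecture.HodgeConjecture.Theorems.F0P5LemD14IfNonsplitLetter
import Summits.HodgeConjecture.HodgeConjecture.Theorems.F0P5PaydownStubRelabelUnit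
import Summits.HodgeConjecture.HodgeConjecture.Theorems.F0P5CurveThetaStubRelabelParity
import Literature.NumberTheory.Automorphic.Liu2021.CurveThetaNonOrthogonal
import Literature.NumberTheory.Rogawski1990.CurveThetaHodgeTypeNecessity
import Literature.NumberTheory.Automorphic.Liu2021.ThetaLiftFromLineMeets
import Literature.NumberTheory.Automorphic.Liu2021.ThetaLiftFromLineFrame
import Literature.NumberTheory.Automorphic.Liu2021.ThetaLiftFromLineArchAssembly
import Literature.NumberTheory.Automorphic.Liu2021.ThetaLiftFromLineIrreducible
import Literature.NumberTheory.Automorphic.Liu2021.LemD1RankTwoCMSameLabelLetter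
import Literature.NumberTheory.Automorphic.Liu2021.LemD1RankTwoCMLetters
import Literature.NumberTheory.ComplexMultiplication.CMTypeBasic
import HarnessLib

/-!
# F2 — the printed theta row #74R `Rogawski1990.curveThetaHodgeTypeNecessity_hol_pos` FROM THE ONE PRINTED LETTER #184♮
# `Liu2021.curveTheta_nonOrthogonal₂`, Theorems-side (importable), sorry-free

Cell hodgecm-mathlib FLOOR 0, programme P6, crux `hLiu418` = `stmt-HodgeConjecture-24832`; «M-152» SEQUEL ★ chain (LA2-p03 (g9) map 2026-09-03T05:57Z:
F1 #73-of-letter, **F2 = this file**, F3 the F0 folds, F4 the `a3_liu418` face glue, F5 the ★ conditional closer of `…HCCMUnconditional.HLiu418` from the one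
letter + the route items `H21`, `H413`).  Namespace `Summit.HodgeConjecture.HodgeConjecture.Cruxes.HLiu418.F0P6LD2StubS1bFactsOfA2P`.

WHAT IS PROVED (two closed theorems, axioms TRIO):
* `pinnedHolNecessity₂'_of_curveTheta_nonOrthogonal₂ : Liu2021.curveTheta_nonOrthogonal₂ → ‹G2′ body›` — G2′ = the LD2 organ-road leaf's
  `F0P6LD2StubS1bFacts.PinnedHolNecessity₂'` (`Cruxes/HLiu418/Lines/F0_P6LD_StubS1bFactsOrganRoad.lean` ED. 11 :621) SPELLED OUT token for token (a `Lines`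
  module is consumed BY TYPE, never by import), proved by the leaf's kernel-checked glue `pinnedHolNecessity₂'_of_organs` (:848) with EVERY organ fed BY NAME from its ★
  `Theorems` source: A₂ ★ `F0LD1ThetaRealisationOfOrthogonalCopy.thetaRealisation₂_of_orthogonalCopy ‹letter› ‹(I′)› ‹pin›` (ROAD O; (I′) = ★
  `F0LD1ThetaIrrOfGerm.thetaLiftFromLineIrreducible_of_thetaGerm₂` over ★ `F0LD1ThetaGermDefs.thetaGerm₂_of_dichotomy_slice` of the six ★ local bricks, pin = ★
  `F0LD1ThetaSpanPinOfBricks.thetaSpanPin₂_holds`), B₂ ★ `F0LD2ThetaFinComponent.thetaFinComponent₂_holds`, U₂″ ★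
  `F0LD2SameLabelClassesOfAFUCompact.sameLabelClasses₂_of_sameLabel` ∘ ★ `F0LD2LetterR2OfLineComplementary.lemD1_4SameLabelNonsplitCM₂_of_lineThetaTypesComplementary₁` ∘ ★
  `F0LD2SoftRoadJunction.lineThetaTypesComplementary₁_of_zVan zVan_holds`, C₂at′ ★ `F0LD2ArchSignAt.archSignAt₂'_holds`, C₂away ★ `F0LD2ArchTypeAway.archTypeAway₂_holds`,
  ARITH₂ ★ `F0LD2PinToAdmissible.pinToAdmissible₂_holds`, compactness of `[U(diag dV)]` ★ `F0LD2ArchAdmissibleAssembly.compactSpace_quotient_diagonal_of_posDef`.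
* `curveThetaHodgeTypeNecessity_hol_pos_of_curveTheta_nonOrthogonal₂ : Liu2021.curveTheta_nonOrthogonal₂ → Rogawski1990.curveThetaHodgeTypeNecessity_hol_pos` — #74R
  ([Liu2021, Rem. D.5] necessity half, oriented re-letter ★ p848618) by the leaf's certificate `paydownCertificate₇₄Pos` (:904) «G2′, R2′, R1, A ⇒ #74R» with R2′ ★
  `F0P5CurveThetaCompanionRelabelOfNonsplitIfLetter.companionRelabelTransfer₂_of_nonsplit_if_letter` ∘ ★ `F0P5LemD14IfNonsplitLetter.lemD1_4IfAsPrintedNonsplitCM₂_holds`, R1 ★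
  `F0P5PaydownStubRelabelUnit.stub_arith_relabelUnit_holds`, A ★ `F0P5CurveThetaStubRelabelParity.relabelParity_holds` (the P5 paydown `Lines` leaf's closed stubs :656∕:661∕:666,
  re-spelled by their ★ heads).

HONEST SCOPE.  This file BOOKS NOTHING and discharges no printed citation: it is the LD2 leaf's composition with its one `sorry` (the letter stub
`stub_letter_A₂P_hodgeFree`, #184♮ = [Liu2021, Thm. B.4 (1)], resting on [GinzburgJiangSoudry2009, Thm. 1.1]) turned into a HYPOTHESIS, so that the dependence
«#74R ⇐ #184♮» is a kernel-checked ★ implication importable from `Theorems/` (F3 ∕ F5 consume it; the registry edition of `Lines/d6_cm_curve` may import the `Lines` leaves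
directly and does not need it).  The leaf (`Lines`) is untouched.  HC_CM is proved only modulo the 7 printed citations (2 remaining: hLiu418 = stmt-HodgeConjecture-24832,
h413 = stmt-HodgeConjecture-24833) until rung 0 closes.

## References
* [Liu2021] Y. Liu, Camb. J. Math. 9 (2021) = arXiv:2102.11518: App. D Rem. D.5 (p. 131), proof of Prop. D.4 (1) (p. 130 L34 – p. 131 L21), Lem. D.1 (4) (p. 126),
  Lem. D.2 (1), (3) (p. 127–128), Def. 4.12; App. B Thm. B.4 (1), (2) (p. 98), Cor. B.6 (p. 99).
* [Rogawski1990] J. Rogawski, Ann. of Math. Stud. 123 (1990), §11, Thm. 11.5.1.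
* [GinzburgJiangSoudry2009] D. Ginzburg, D. Jiang, D. Soudry, J. Inst. Math. Jussieu 8 (2009), Thm. 1.1 (source of the hypothesis only).
* [PlatonovRapinchuk1994] V. Platonov, A. Rapinchuk, Pure Appl. Math. 139 (1994), §5.3 Thm. 5.5 (compactness of anisotropic quotients).
-/

set_option autoImplicit false
-- the mandated namespace has the single-problem summit's repeated segment (`HodgeConjecture.HodgeConjecture`)
set_option linter.dupNamespace false

noncomputable section

open NumberField NumberField.InfinitePlace MeasureTheory IsDedekindDomain
open scoped Matrix ComplexOrder
open Literature.NumberTheory.Automorphic Literature.NumberTheory.Automorphic.UnitaryGroup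
open Literature.NumberTheory.Automorphic.UnitaryCurveForms
open Literature.NumberTheory.Automorphic.Liu2021 Literature.NumberTheory.Automorphic.Liu2021.Def411WeilCarriers
open Literature.NumberTheory.Automorphic.Liu2021.Def411WeilCarriersDoubling
open Literature.NumberTheory.GaloisRepresentations Literature.NumberTheory.Automorphic.IdeleClassGroup
open Literature.NumberTheory.GelbartRogawski1991 Literature.NumberTheory.GelbartRogawski1991.UnitaryDualPair
open Literature.AlgebraicGeometry.Liu2021 (IsAdmissibleElement)
open Literature.AlgebraicGeometry.Motives (CMType)
open Literature.NumberTheory.ComplexMultiplication (CMTypeOps.bar CMTypeOps.mem_bar_iff)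
open Literature.RepresentationTheory.Liu2021 Literature.RepresentationTheory.HarrisKudlaSweet1996
open Literature.NumberTheory.Rogawski1990

namespace Summit.HodgeConjecture.HodgeConjecture.Cruxes.HLiu418.F0P6LD2StubS1bFactsOfA2P

/-- **G2′ FROM THE LETTER** — the pinned holomorphic necessity `PinnedHolNecessity₂'` of the LD2 organ road (its `def` body, `Lines/F0_P6LD_StubS1bFactsOrganRoad.lean`
:621, spelled out token for token): in the frame of #74R (`ᵗḡ (t•H) g = diag dV`, `0 < ι t` real, signature `(1,1)` at `ι`, definite elsewhere, `[L:ℚ] ≥ 4`), for a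
cone frame `𝔣`, a weight-one conjugate-symplectic label `λ` PINNED at `ι` (`e♮ ∈ Φ_λ`), a line `a`, `χ`, and the θ-type finite component `σ ↪ ω(λ, ε_a, χ)_f`, every
discrete `P` holomorphic-cotangent at `𝔣` with finite component `σ` forces `ε_a` to be `Φ_λ`-ADMISSIBLE.  Proof = the leaf's glue `pinnedHolNecessity₂'_of_organs`
verbatim with the organs BY NAME from `Theorems/`: compactness ★ `compactSpace_quotient_diagonal_of_posDef`; A₂ ★ `thetaRealisation₂_of_orthogonalCopy` fed THE
HYPOTHESIS `hA₂P`, the closed letter (I′) (★ `thetaLiftFromLineIrreducible_of_thetaGerm₂` of ★ `thetaGerm₂_of_dichotomy_slice` of the six ★ bricks) and the ★ pin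
`thetaSpanPin₂_holds`; B₂ ★ `thetaFinComponent₂_holds`; U₂″ ★ `sameLabelClasses₂_of_sameLabel (lemD1_4SameLabelNonsplitCM₂_of_lineThetaTypesComplementary₁
(lineThetaTypesComplementary₁_of_zVan zVan_holds))`; C₂at′ ★ `archSignAt₂'_holds`; C₂away ★ `archTypeAway₂_holds`; ARITH₂ ★ `pinToAdmissible₂_holds`.
[cite: Liu2021, App. D Rem. D.5 (p. 131); proof of Prop. D.4 (1) (p. 130–131); Lem. D.1 (4) (p. 126); Lem. D.2 (1), (3) (p. 127–128); Def. 4.12; App. B Thm. B.4 (1), (2) (p. 98)]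
[cite: PlatonovRapinchuk1994, §5.3 Thm. 5.5] -/
theorem pinnedHolNecessity₂'_of_curveTheta_nonOrthogonal₂
    (hA₂P : Literature.NumberTheory.Automorphic.Liu2021.curveTheta_nonOrthogonal₂) :
    ∀ (L : Type) [Field L] [NumberField L] [IsCMField L] (ι : L →+* ℂ) (H : Matrix (Fin 2) (Fin 2) L)
      (dV : Fin 2 → L) (hdV : ∀ i, IsCMField.complexConj L (dV i) = dV i) (hdV0 : ∀ i, dV i ≠ 0)
      (t : L) (ht : t ≠ 0) (hτt : 0 < (ι t).re) (hτt' : (ι t).im = 0) (g : GL (Fin 2) L)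
      (hg : formCongr ((IsCMField.complexConj L : L ≃ₐ[↥(maximalRealSubfield L)] L) : L →+* L) g (t • H) = Matrix.diagonal dV),
      (∃ T : GL (Fin 2) ℂ, formCongr (starRingEnd ℂ) T ((Matrix.diagonal dV).map ι) = Matrix.diagonal ![(1 : ℂ), -1]) →
      (∀ τ' : L →+* ℂ, InfinitePlace.mk τ' ≠ InfinitePlace.mk ι → ((Matrix.diagonal dV).map τ').PosDef) →
      4 ≤ Module.finrank ℚ L →
      ∀ (𝔣 : ConeFrame L H (cmPlace L ι))
        (μ : Measure (adelicGroupData (↥(maximalRealSubfield L)) L (IsCMField.complexConj L) 2 H).automorphicQuotient)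
        [(adelicGroupData (↥(maximalRealSubfield L)) L (IsCMField.complexConj L) 2 H).IsAutomorphicMeasure μ]
        {n' : ℕ} (e₁ : Fin 2 × Fin 1 ≃ Fin n')
        (lam : Literature.NumberTheory.Automorphic.IdeleClassGroup L →ₜ* Circle) (hlam : IsConjugateSymplectic L lam), HasWeight L lam 1 →
      ∀ (a : (↥(maximalRealSubfield L))ˣ) (χ : Chi (↥(maximalRealSubfield L)) L (IsCMField.complexConj L))
        (W : Type) [AddCommGroup W] [Module ℂ W]
        (σ : Representation ℂ (finAdelic (↥(maximalRealSubfield L)) L (IsCMField.complexConj L) 2 H) W),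
        σ.IsIrreducible → σ.IsSmooth →
      ∀ j : σ.IntertwiningMap
          ((rhoVAtLine (↥(maximalRealSubfield L)) L (IsCMField.complexConj L) 2 e₁ (Matrix.diagonal dV)
              (complexConj_imagUnit L) (imagUnit_ne_zero L) (imagUnit_mul_self L) (realDiagonal_isSymm L dV hdV)
              (isUnit_det_realDiagonal L dV hdV hdV0) (realDiagonal_map L dV hdV).symm
              (fun a => isCompatible_chiSplittingLine L e₁ dV hdV hdV0 (toHeckeCharacter L lam)
                (isUnitary_toHeckeCharacter L lam) ((isOscillatorChar_toHeckeCharacter_iff lam).mpr hlam)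
                (TW (↥(maximalRealSubfield L)) a) (isSymm_TW (↥(maximalRealSubfield L)) a)
                (isUnit_det_TW (↥(maximalRealSubfield L)) a) (JW (↥(maximalRealSubfield L)) L a)
                (JW_eq (↥(maximalRealSubfield L)) L a)) a χ).comp
            (finAdelicCongr (↥(maximalRealSubfield L)) L (IsCMField.complexConj L) g ht hg).symm.toMonoidHom),
        Function.Injective j →
      (cmPlace L ι).1.embedding ∈ hlam.cmType.1 →
      ∀ P : DiscreteAutomorphicRep (adelicGroupData (↥(maximalRealSubfield L)) L (IsCMField.complexConj L) 2 H) μ,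
        P.IsHolCotangentAt₂ (IsCMField.complexConj_ne_one L) (UnitaryGroup.complexConj_smul_infinitePlace L) (cmPlace L ι) 𝔣 →
        P.HasFinComponent σ →
        ∃ e : L, IsAdmissibleElement L hlam.cmType.1 e ∧
          epsOf (↥(maximalRealSubfield L)) (imagUnitSq L) L (2 * imagUnit L)⁻¹ e = locF (↥(maximalRealSubfield L)) (imagUnitSq L) a := by
  intro L _ _ _ ι H dV hdV hdV0 t ht hτt hτt' g hg hsig hdef h4 𝔣 μ _ n' e₁ lam hlam hw a χ W _ _ σ hirr hsm j hj hpin P hP hfin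
  haveI := Summit.HodgeConjecture.HodgeConjecture.Cruxes.HLiu418.F0LD2ArchAdmissibleAssembly.compactSpace_quotient_diagonal_of_posDef L 2 dV ι hdef h4
  -- A₂ (ROAD O): realisation from the LETTER (the hypothesis), the closed letter (I′) over the six ★ local bricks, and the ★ unitary-class pin
  obtain ⟨ιA, hιA, a', hmeet⟩ :=
    Summit.HodgeConjecture.HodgeConjecture.Cruxes.HLiu418.F0LD1ThetaRealisationOfOrthogonalCopy.thetaRealisation₂_of_orthogonalCopy hA₂P
      (Summit.HodgeConjecture.HodgeConjecture.Cruxes.HLiu418.F0LD1ThetaIrrOfGerm.thetaLiftFromLineIrreducible_of_thetaGerm₂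
        (Summit.HodgeConjecture.HodgeConjecture.Cruxes.HLiu418.F0LD1ThetaGermDefs.thetaGerm₂_of_dichotomy_slice
          (Summit.HodgeConjecture.HodgeConjecture.Cruxes.HLiu418.F0LD1ThetaDichotomyOfBricks.thetaDichotomy₂_of_localBricks
            Summit.HodgeConjecture.HodgeConjecture.Cruxes.HLiu418.F0LD1ThetaSliceHermiteSum.hermiteSum_holds
            Summit.HodgeConjecture.HodgeConjecture.Cruxes.HLiu418.F0LD1ThetaSliceTorusProjector.torusProjector_holds
            Summit.HodgeConjecture.HodgeConjecture.Cruxes.HLiu418.F0LD1ThetaSliceFiniteLevel.finiteLevel_holds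
            Summit.HodgeConjecture.HodgeConjecture.Cruxes.HLiu418.F0LD1ThetaSliceMeasureScaling.measureScaling_holds
            Summit.HodgeConjecture.HodgeConjecture.Cruxes.HLiu418.F0LD1ThetaArchLadder.archLadder_holds
            Summit.HodgeConjecture.HodgeConjecture.Cruxes.HLiu418.F0LD1ThetaFinGeneration.finGeneration_holds)
          (Summit.HodgeConjecture.HodgeConjecture.Cruxes.HLiu418.F0LD1ThetaSliceOfBricks.thetaSlice₂_of_bricks
            Summit.HodgeConjecture.HodgeConjecture.Cruxes.HLiu418.F0LD1ThetaSliceHermiteSum.hermiteSum_holds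
            Summit.HodgeConjecture.HodgeConjecture.Cruxes.HLiu418.F0LD1ThetaSliceTorusProjector.torusProjector_holds
            Summit.HodgeConjecture.HodgeConjecture.Cruxes.HLiu418.F0LD1ThetaSliceFiniteLevel.finiteLevel_holds
            Summit.HodgeConjecture.HodgeConjecture.Cruxes.HLiu418.F0LD1ThetaSliceMeasureScaling.measureScaling_holds)))
      Summit.HodgeConjecture.HodgeConjecture.Cruxes.HLiu418.F0LD1ThetaSpanPinOfBricks.thetaSpanPin₂_holds
      L ι H dV hdV hdV0 t ht g hg hsig hdef h4 𝔣 μ e₁ lam hlam hw a χ W σ hirr hsm j hj P hP hfin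
  -- B₂: the finite component of the realising theta lift
  obtain ⟨χ', hnt, hfin'⟩ :=
    Summit.HodgeConjecture.HodgeConjecture.Cruxes.HLiu418.F0LD2ThetaFinComponent.thetaFinComponent₂_holds
      L ι H dV hdV hdV0 t ht g hg hsig hdef h4 𝔣 μ e₁ ιA hιA P lam hlam a' hmeet hP
  -- U₂″: same-label classes, over the closed letter R₂ (★ of the soft road's `ZVan`)
  have hcls :=
    Summit.HodgeConjecture.HodgeConjecture.Cruxes.HLiu418.F0LD2SameLabelClassesOfAFUCompact.sameLabelClasses₂_of_sameLabel
      (Summit.HodgeConjecture.HodgeConjecture.Cruxes.HLiu418.F0LD2LetterR2OfLineComplementary.lemD1_4SameLabelNonsplitCM₂_of_lineThetaTypesComplementary₁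
        (Summit.HodgeConjecture.HodgeConjecture.Cruxes.HLiu418.F0LD2SoftRoadJunction.lineThetaTypesComplementary₁_of_zVan
          Summit.HodgeConjecture.HodgeConjecture.Cruxes.HLiu418.F0LD2SoftRoadJunction.zVan_holds))
      L ι H dV hdV hdV0 t ht g hg hsig hdef h4 𝔣 μ e₁ lam hlam hw a χ W σ hirr hsm j hj P hP hfin a' χ' hnt hfin'
  -- C₂at′ and C₂away: the archimedean table
  have hat :=
    Summit.HodgeConjecture.HodgeConjecture.Cruxes.HLiu418.F0LD2ArchSignAt.archSignAt₂'_holds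
      L ι H dV hdV hdV0 t ht hτt hτt' g hg hsig hdef h4 𝔣 μ e₁ ιA hιA P lam hlam a' hmeet hP
  have haway :=
    Summit.HodgeConjecture.HodgeConjecture.Cruxes.HLiu418.F0LD2ArchTypeAway.archTypeAway₂_holds
      L ι H dV hdV hdV0 t ht g hg hsig hdef h4 𝔣 μ e₁ ιA hιA P lam hlam a' hmeet hP
  -- ARITH₂ closes with the pin
  refine Summit.HodgeConjecture.HodgeConjecture.Cruxes.HLiu418.F0LD2PinToAdmissible.pinToAdmissible₂_holds
    L ι dV hdV hdV0 hsig hdef h4 hlam.cmType hlam.cmType a a' hpin hat ?_ ?_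
  · intro τ' hτ' hmem
    rcases haway τ' hτ' with ⟨-, h⟩ | ⟨h1, -⟩
    · exact h
    · exfalso
      change exponentAt hlam.infinityType τ' < 0 at hmem
      rw [h1] at hmem
      norm_num at hmem
  · exact Or.inl ⟨rfl, hcls⟩

/-- **#74R FROM THE ONE PRINTED LETTER #184♮** — the oriented necessity half of [Liu2021, Rem. D.5] for the theta packets of the CM unitary curve
(★ re-letter `Rogawski1990.curveThetaHodgeTypeNecessity_hol_pos`, p848618: if a discrete `P` of `U(H)` is holomorphic-cotangent at `𝔣` and has the θ-type finite
component `σ ↪ ω(λ, ε_a, χ)_f`, then `ε_a` is admissible for the CM type pinned at `ι`) from the Hodge-free non-orthogonality letter `Liu2021.curveTheta_nonOrthogonal₂`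
ALONE.  Proof = the LD2 leaf's certificate `paydownCertificate₇₄Pos` «G2′, R2′, R1, A ⇒ #74R» verbatim: were `e♮ ∉ Φ_λ`, relabel by the unit `a′` (R1 ★
`stub_arith_relabelUnit_holds`) and the companion label `λ′` with `Φ_{λ′} = Φ̄_λ ∋ e♮` (R2′ ★ `companionRelabelTransfer₂_of_nonsplit_if_letter` of ★
`lemD1_4IfAsPrintedNonsplitCM₂_holds`); G2′ (above, from the letter) makes `ε_{a′}` admissible for `Φ̄_λ`, against the parity obstruction A ★ `relabelParity_holds`.
[cite: Liu2021, App. D Rem. D.5 (p. 131); Lem. D.1 (4) (p. 126); Def. 4.12] [cite: Rogawski1990, §11 Thm. 11.5.1] -/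
theorem curveThetaHodgeTypeNecessity_hol_pos_of_curveTheta_nonOrthogonal₂
    (hA₂P : Literature.NumberTheory.Automorphic.Liu2021.curveTheta_nonOrthogonal₂) :
    Literature.NumberTheory.Rogawski1990.curveThetaHodgeTypeNecessity_hol_pos := by
  intro L _ _ _ ι H dV hdV hdV0 t ht hτt hτt' g hg hsig hdef h4 𝔣 μ _ n' e₁ lam hlam hw a χ W _ _ σ hirr hsm j hj P hP hfin hadm
  by_contra hnot
  obtain ⟨a', hflip⟩ :=
    Summit.HodgeConjecture.HodgeConjecture.Cruxes.HLiu418.F0P5PaydownStubRelabelUnit.stub_arith_relabelUnit_holds L ι dV hdV hdV0 hsig hdef h4 a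
  obtain ⟨lam', hlam', hw', hΦ', j', hj'⟩ :=
    Summit.HodgeConjecture.HodgeConjecture.Cruxes.HLiu418.F0P5CurveThetaCompanionRelabelOfNonsplitIfLetter.companionRelabelTransfer₂_of_nonsplit_if_letter
      Summit.HodgeConjecture.HodgeConjecture.Cruxes.HLiu418.F0P5LemD14IfNonsplitLetter.lemD1_4IfAsPrintedNonsplitCM₂_holds
      L ι H dV hdV hdV0 t ht g hg hsig hdef h4 e₁ lam hlam hw a χ W σ hirr hsm j hj a' hflip
  have hpin' : (cmPlace L ι).1.embedding ∈ hlam'.cmType.1 := by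
    rw [hΦ']
    exact (CMTypeOps.mem_bar_iff _ _).mpr hnot
  have hadm' := pinnedHolNecessity₂'_of_curveTheta_nonOrthogonal₂ hA₂P L ι H dV hdV hdV0 t ht hτt hτt' g hg hsig hdef h4 𝔣 μ e₁
    lam' hlam' hw' a' χ W σ hirr hsm j' hj' hpin' P hP hfin
  rw [hΦ'] at hadm'
  exact Summit.HodgeConjecture.HodgeConjecture.Cruxes.HLiu418.F0P5CurveThetaStubRelabelParity.relabelParity_holds L ι dV hdV hdV0 hsig hdef h4 hlam.cmType a a' hflip hadm hadm'

end Summit.HodgeConjecture.HodgeConjecture.Cruxes.HLiu418.F0P6LD2StubS1bFactsOfA2P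

end
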